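import Literature.ModelTheory.Zilber.EACDensityAligned
import HarnessLib

/-!
# Polynomially parametrised base curves, I: root directions with a sign constraint

HONEST FRAMING.  Cell `pub-schanuel` (Zilber's Exponential-Algebraic Closedness, case ladder;
host summit Schanuel), seat 2, gen 19.  First file of the series deciding Mantova–Masser's
"unprojected density" question (PLMS 2024, §1 p. 5; OPEN in general) for product surfaces
`C × Z(P) ⊆ ℂ² × ℂ²` over a POLYNOMIALLY PARAMETRISED base curve `C = {(g₀(t), g₁(t))}` — the
first base curves of the cell's node map that are not graphs over a coordinate axis (e.g. the
cuspidal cubic `x₀³ = x₁²`, `t ↦ (t², t³)`).  NOT Schanuel's conjecture (neither used nor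
implied; EAC ⇏ SC); `EC(3,2)` stays OPEN.

THE COMBINATORIAL INPUT.  The Newton-polygon escape of gen 16 (`ZilberEacGraphCurveEscape`)
runs along exact roots of `R(t) = 2πi N + log θ` in a root direction `ω` of `R`
(`lc(R) ω^{deg R} = ±2πi`); over a graph base `x₀ = t` the direction was chosen with `Re ω < 0`
so that `e^{x₀}` degenerates.  Over a parametrised base the degenerating coordinate is
`x₀ = g₀(t)`, of size `Re(lc(g₀) ω^{deg g₀}) · k^{deg g₀}` along the ray, and we need a root
direction of `R` on which this leading real part is NEGATIVE:
* `exists_rootDirection_re_neg_of_not_dvd`: if `deg R = d ∤ m = deg g₀` (e.g. `m < d`), then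
  among the `2d` root directions `ω₀ e^{iπk/d}` of `R` there is one with `Re(b ω^m) < 0`, for any
  `b ≠ 0` (the angles `πkm/d` run through a subgroup of `ℝ/2πℤ` of index `2d/gcd(m,2d) ≥ 3`,
  whose cosets meet every arc of length `2π/3`);
* `exists_rootDirection_re_neg_of_im_ne_zero`: if `m = d` and `b/a ∉ ℝ` (`a = lc R`), then
  `Re(b ω^d) = ∓2π Im(b/a)` alternates in sign between consecutive root directions.
-/

noncomputable section

open Complex
open Literature.ModelTheory.Zilber

set_option linter.dupNamespace false

namespace Summit.Schanuel.Schanuel.Theorems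

/-- `(ω e^{ix})^n = ω^n e^{inx}`. -/
theorem mul_exp_mul_I_pow (ω : ℂ) (x : ℝ) (n : ℕ) :
    (ω * exp ((x : ℂ) * I)) ^ n = ω ^ n * exp ((((n : ℝ) * x : ℝ) : ℂ) * I) := by
  rw [mul_pow, ← Complex.exp_nat_mul]
  push_cast
  ring_nf

/-- `Re (c e^{ix}) = ‖c‖ cos (arg c + x)`. -/
theorem re_mul_exp_mul_I (c : ℂ) (x : ℝ) :
    (c * exp ((x : ℂ) * I)).re = ‖c‖ * Real.cos (Complex.arg c + x) := by
  conv_lhs => rw [← Complex.norm_mul_exp_arg_mul_I c]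
  rw [mul_assoc, ← Complex.exp_add]
  have : (Complex.arg c : ℂ) * I + (x : ℂ) * I = (((Complex.arg c + x : ℝ)) : ℂ) * I := by
    push_cast; ring
  rw [this, Complex.re_ofReal_mul, Complex.exp_ofReal_mul_I_re]

/-- Rotating a root direction by `e^{iπk/d}` gives a root direction (the sign may flip). -/
theorem rootDirection_rotate {a ω : ℂ} {d : ℕ} (hd : d ≠ 0) {s : ℤ} (hs : s = 1 ∨ s = -1)
    (hω : a * ω ^ d = 2 * Real.pi * I * s) (k : ℤ) :
    ∃ s' : ℤ, (s' = 1 ∨ s' = -1) ∧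
      a * (ω * exp ((((Real.pi * k / d : ℝ)) : ℂ) * I)) ^ d = 2 * Real.pi * I * s' := by
  obtain ⟨σ, hσ, hexp⟩ := exists_sign_exp_pi_mul_int k
  have hdR : (d : ℝ) ≠ 0 := Nat.cast_ne_zero.mpr hd
  refine ⟨s * σ, ?_, ?_⟩
  · rcases hs with rfl | rfl <;> rcases hσ with rfl | rfl <;> simp
  · rw [mul_exp_mul_I_pow, ← mul_assoc, hω]
    have : (((d : ℝ) * (Real.pi * k / d) : ℝ) : ℂ) * I = (Real.pi : ℂ) * k * I := by
      have : (d : ℝ) * (Real.pi * k / d) = Real.pi * k := by field_simp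
      rw [this]; push_cast; ring
    rw [this, hexp]
    push_cast; ring

/-- **Root directions with a negative leading real part, unequal degrees.**  If `a, b ≠ 0`,
`d ≥ 2` and `d ∤ m`, there is a root direction `ω` of `a X^d` (`a ω^d = ±2πi`) with
`Re(b ω^m) < 0`. (new) -/
theorem exists_rootDirection_re_neg_of_not_dvd (a b : ℂ) (ha : a ≠ 0) (hb : b ≠ 0) {d m : ℕ}
    (hd : 2 ≤ d) (hdm : ¬ d ∣ m) :
    ∃ (ω : ℂ) (s : ℤ), (s = 1 ∨ s = -1) ∧ a * ω ^ d = 2 * Real.pi * I * s ∧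
      (b * ω ^ m).re < 0 := by
  obtain ⟨ω₀, s₀, hs₀, hω₀, -⟩ := exists_rootDirection a ha d hd
  have hd0 : d ≠ 0 := by omega
  have hdpos : (0 : ℝ) < d := by exact_mod_cast (show 0 < d by omega)
  have hω₀0 : ω₀ ≠ 0 := by
    rintro rfl
    rw [zero_pow hd0, mul_zero] at hω₀
    have hsC : (s₀ : ℂ) ≠ 0 := by rcases hs₀ with rfl | rfl <;> simp
    have hπ : (Real.pi : ℂ) ≠ 0 := Complex.ofReal_ne_zero.mpr Real.pi_pos.ne'
    exact absurd hω₀.symm (by simp [hsC, hπ, Complex.I_ne_zero])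
  set c : ℂ := b * ω₀ ^ m with hc_def
  have hc0 : c ≠ 0 := mul_ne_zero hb (pow_ne_zero _ hω₀0)
  have hcpos : 0 < ‖c‖ := norm_pos_iff.mpr hc0
  -- `g = gcd(m, 2d)`, `2d = g q` with `q ≥ 3`
  set g : ℕ := Nat.gcd m (2 * d) with hg_def
  have hgpos : 0 < g := Nat.gcd_pos_of_pos_right _ (by omega)
  obtain ⟨q, hq⟩ : g ∣ 2 * d := Nat.gcd_dvd_right m (2 * d)
  have hgm : g ∣ m := Nat.gcd_dvd_left m (2 * d)
  have hq3 : 3 ≤ q := by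
    by_contra hlt
    push Not at hlt
    interval_cases q
    · omega
    · -- `g = 2d ∣ m`
      apply hdm
      rw [mul_one] at hq
      exact Nat.dvd_trans (Dvd.intro 2 (by omega)) hgm
    · -- `g = d ∣ m`
      apply hdm
      have : g = d := by omega
      rw [← this]; exact hgm
  have hgR : (0 : ℝ) < g := by exact_mod_cast hgpos
  have hqR : (3 : ℝ) ≤ q := by exact_mod_cast hq3
  have h2d : (2 : ℝ) * d = g * q := by exact_mod_cast hq
  -- Bezout
  have hbez : ((g : ℕ) : ℤ) = (m : ℤ) * Nat.gcdA m (2 * d) + ((2 * d : ℕ) : ℤ) * Nat.gcdB m (2 * d) :=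
    Nat.gcd_eq_gcd_ab m (2 * d)
  set u : ℤ := Nat.gcdA m (2 * d) with hu
  set v : ℤ := Nat.gcdB m (2 * d) with hv
  have hbezR : (g : ℝ) = (m : ℝ) * u + 2 * d * v := by
    have := congrArg (fun z : ℤ => (z : ℝ)) hbez
    push_cast at this
    linarith
  -- the angle bookkeeping
  set β : ℝ := Complex.arg c with hβ
  set j : ℤ := round ((Real.pi - β) * d / (Real.pi * g)) with hj
  set kk : ℤ := u * j with hkk
  set ψ : ℝ := Real.pi * kk / d with hψ
  obtain ⟨s, hs, hωs⟩ := rootDirection_rotate hd0 hs₀ hω₀ kk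
  refine ⟨ω₀ * exp ((ψ : ℂ) * I), s, hs, hωs, ?_⟩
  rw [mul_exp_mul_I_pow, ← mul_assoc, re_mul_exp_mul_I]
  -- `m ψ = π j g / d - 2π (j v)`
  have hmu : (m : ℝ) * u = g - 2 * d * v := by linarith
  have hdR : (d : ℝ) ≠ 0 := Nat.cast_ne_zero.mpr hd0
  have hmψ : (m : ℝ) * ψ = Real.pi * j * g / d - ((j * v : ℤ) : ℝ) * (2 * Real.pi) := by
    have e1 : (m : ℝ) * ψ = Real.pi * j * ((m : ℝ) * u) / d := by
      rw [hψ, hkk]; push_cast; ring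
    rw [e1, hmu]
    push_cast
    field_simp
  have hcos : Real.cos (β + (m : ℝ) * ψ) = Real.cos (β + Real.pi * j * g / d) := by
    rw [hmψ, ← add_sub_assoc, Real.cos_sub_int_mul_two_pi]
  -- `β + π j g/d = π + ε`, `|ε| ≤ π/3`
  set ε : ℝ := Real.pi * j * g / d - (Real.pi - β) with hε
  have hround := abs_sub_round ((Real.pi - β) * d / (Real.pi * g))
  rw [← hj] at hround
  have hεb : |ε| ≤ Real.pi / 3 := by
    have hπ := Real.pi_pos
    have hstep : 0 < Real.pi * g / d := by positivity
    have h0 : ε = -((((Real.pi - β) * d / (Real.pi * g) - j)) * (Real.pi * g / d)) := by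
      rw [hε]; field_simp; ring
    have h1 : |ε| = |((Real.pi - β) * d / (Real.pi * g) - j)| * (Real.pi * g / d) := by
      rw [h0, abs_neg, abs_mul, abs_of_pos hstep]
    rw [h1]
    calc |((Real.pi - β) * d / (Real.pi * g) - j)| * (Real.pi * g / d)
        ≤ (1 / 2) * (Real.pi * g / d) := mul_le_mul_of_nonneg_right hround hstep.le
      _ = Real.pi / q := by
          have hq0 : (q : ℝ) ≠ 0 := by linarith
          field_simp
          linarith [h2d]
      _ ≤ Real.pi / 3 := div_le_div_of_nonneg_left hπ.le (by norm_num) hqR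
  have hcosε : 1 / 2 ≤ Real.cos ε := by
    have h1 : Real.cos (Real.pi / 3) ≤ Real.cos (|ε|) :=
      Real.cos_le_cos_of_nonneg_of_le_pi (abs_nonneg _) (by linarith [Real.pi_pos]) hεb
    rw [Real.cos_abs, Real.cos_pi_div_three] at h1
    exact h1
  have hang : β + Real.pi * j * g / d = ε + Real.pi := by rw [hε]; ring
  rw [hcos, hang, Real.cos_add_pi]
  nlinarith

/-- **Root directions with a negative leading real part, equal degrees.**  If `a ≠ 0`, `d ≥ 2`
and `b/a ∉ ℝ`, there is a root direction `ω` of `a X^d` with `Re(b ω^d) < 0`. (new) -/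
theorem exists_rootDirection_re_neg_of_im_ne_zero (a b : ℂ) (ha : a ≠ 0) {d : ℕ} (hd : 2 ≤ d)
    (him : (b / a).im ≠ 0) :
    ∃ (ω : ℂ) (s : ℤ), (s = 1 ∨ s = -1) ∧ a * ω ^ d = 2 * Real.pi * I * s ∧
      (b * ω ^ d).re < 0 := by
  obtain ⟨ω₀, s₀, hs₀, hω₀, -⟩ := exists_rootDirection a ha d hd
  have hd0 : d ≠ 0 := by omega
  have hc : b * ω₀ ^ d = (b / a) * (2 * Real.pi * I * s₀) := by
    rw [← hω₀]; field_simp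
  have hre : (b * ω₀ ^ d).re = -(2 * Real.pi * s₀) * (b / a).im := by
    rw [hc, Complex.mul_re]
    have h1 : (2 * Real.pi * I * (s₀ : ℂ)).re = 0 := by simp [Complex.mul_re]
    have h2 : (2 * Real.pi * I * (s₀ : ℂ)).im = 2 * Real.pi * s₀ := by simp [Complex.mul_im]
    rw [h1, h2]; ring
  have hne : (b * ω₀ ^ d).re ≠ 0 := by
    rw [hre]
    have hs0 : (s₀ : ℝ) ≠ 0 := by rcases hs₀ with rfl | rfl <;> simp
    have : -(2 * Real.pi * (s₀ : ℝ)) ≠ 0 := by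
      have := Real.pi_pos; simp [hs0, Real.pi_pos.ne']
    exact mul_ne_zero this him
  rcases hne.lt_or_gt with hlt | hgt
  · exact ⟨ω₀, s₀, hs₀, hω₀, hlt⟩
  · obtain ⟨s, hs, hωs⟩ := rootDirection_rotate hd0 hs₀ hω₀ 1
    refine ⟨ω₀ * exp ((((Real.pi * (1 : ℤ) / d : ℝ)) : ℂ) * I), s, hs, hωs, ?_⟩
    rw [mul_exp_mul_I_pow, ← mul_assoc]
    have : (((d : ℝ) * (Real.pi * (1 : ℤ) / d) : ℝ) : ℂ) * I = Real.pi * I := by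
      have hdR : (d : ℝ) ≠ 0 := Nat.cast_ne_zero.mpr hd0
      have : (d : ℝ) * (Real.pi * (1 : ℤ) / d) = Real.pi := by push_cast; field_simp
      rw [this]
    rw [this, Complex.exp_pi_mul_I, mul_neg, mul_one, Complex.neg_re]
    linarith

end Summit.Schanuel.Schanuel.Theorems
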